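import Literature.Algebra.EuclideanLattices.SmoothingUniformity
import Literature.Algebra.EuclideanLattices.SmoothingParameterSuccMin
import HarnessLib

/-!
# BLPRS 2013 Lemma 2.7 (Gaussian mass of lattice cosets above the smoothing parameter), the continuous Gaussian `D_s` as a measure, statistical distance of measures

Topic `Algebra/EuclideanLattices` (family `pqc`). This file is the bottom layer (L0) of the
decomposition of Brakerski–Langlois–Peikert–Regev–Stehlé, *Classical hardness of learning with
errors* (STOC 2013) = the named fact
`Literature.Computability.Cryptography.blprs_gapSVP_sqrt_dim_to_lwe_classical` (pqc.S21), and it is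
shared with Regev's and Peikert's worst-case/average-case reductions (pqc.S19, S20): the "known facts
on Gaussian distributions and lattices" collected in BLPRS §2.2, Lemmas 2.5–2.10, which are exactly
the analytic inputs of the modulus-switching theorem (BLPRS Thm 3.1 / Lemma 3.5) and of Regev's
BDD-to-LWE core.

## Results

* `statDist μ ν` (LOCAL GLUE): the statistical (total variation) distance
  `Δ(μ, ν) = sup_A |μ(A) - ν(A)|` of two measures, `A` ranging over measurable sets, real-valued;
  with `statDist_self`, `statDist_comm`, `statDist_nonneg`, `statDist_le_of_forall_abs_sub_le`,
  `abs_measureReal_sub_le_statDist`.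
  The tree has the notion only for `PMF`s (`PMF.tvDist`, `Cryptography/StatisticalDistance.lean`);
  BLPRS Lemmas 2.8–2.10 concern continuous distributions on `ℝⁿ`. Upstreaming candidate
  (`Literature/Probability/`).
* `continuousGaussian E s` : the spherical continuous Gaussian `D_s` on a finite-dimensional real
  inner product space, the measure with density `ρ_s(x)/sⁿ` (`ρ_s = gaussianFunction s`,
  `n = finrank ℝ E`) with respect to Lebesgue measure (BLPRS §2.2), packaged as a `Measure` (the
  tree's `SmoothingUniformity.lean` works with the same density unpackaged:
  `integral_gaussianFunction_sub`, `∫ ρ_s(x - c) dx = sⁿ`); `isProbabilityMeasure_continuousGaussian`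
  (PROVED from those lemmas).
* **BLPRS Lemma 2.7** (Regev 2009), PROVED: for `s ≥ η_ε(L)`,
  `ρ_s(L - c) ∈ [(1-ε)/(1+ε), 1] · ρ_s(L)`. The upper bound (a shift never increases the mass) is
  the tree's `gaussianMass_le_gaussianMass_zero_of_discrete` (`SmoothingParameterSuccMin.lean`,
  MR07 Lemma 2.9, any discrete subgroup); the lower bound is `ofReal_mul_gaussianMass_lattice_le`
  below (from Regev's Claim 3.8 = `abs_gaussianMass_div_sub_one_le_holds`).
* ROADMAP of the remaining BLPRS §2.2 toolkit (checked against the tree 2026-08-15):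
  Lemma 2.5 (GPV08 Lemma 3.1, `η_ε ≤ ‖B̃‖√(ln(2n(1+1/ε))/π)`) is `smoothingParameter_le_norm_gramSchmidt_mul`
  (`SmoothingParameterGramSchmidt.lean`); Lemma 2.6 (MR07 Lemma 4.1, `D_r mod L` is `ε/2`-uniform)
  is PROVED in event form as
  `MicciancioRegev2007.abs_gaussianMeasure_sub_uniform_le_half_of_smoothingParameter_le`
  (`SmoothingUniformity.lean`); GENUINELY ABSENT are **Lemma 2.8** (Regev 2009, Claim 3.9:
  `D_{L+u,r} + D_s ≈_{4ε} D_t`), **Lemma 2.9** (Regev 2009, Cor. 3.10: `⟨z, v⟩ + e ≈_{4ε} D_β`) and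
  **Lemma 2.10** (Peikert 2010, Thm 3.1: `D_r + D_{L-x,s} ≈_{8ε} D_{L,√(r²+s²)}`), whose statements
  (drafted in the provefact notes of pqc.S21) use `statDist` and `continuousGaussian`.

## Conventions and design

* `ρ_s(x) = exp(-π‖x‖²/s²)`, `gaussianMass s c A = ∑_{x ∈ A} ρ_s(x - c)`, the discrete Gaussian
  `discreteGaussian L s c` (mass `∝ ρ_s(x - c)` on `L`) and `smoothingParameter L ε = η_ε(L)` are the
  tree's (`DiscreteGaussian.lean`). The literature's coset Gaussian `D_{L+u,r}` (support `L + u`,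
  mass `∝ ρ_r`) is the image of `discreteGaussian L r (-u)` under `x ↦ x + u`
  (`ρ_r(x + u) = ρ_r(x - (-u))`), and `ρ_r(L + c)` of BLPRS is `gaussianMass r (-c) L`; since every
  statement is quantified over all centres, signs are immaterial.
* Hypotheses `0 < s` accompany `η_ε(L) ≤ s` (automatic in dimension `≥ 1`, where `η_ε > 0`; they
  exclude the junk values of `gaussianFunction`/`discreteGaussian` at `s ≤ 0` in the zero space).
* Everything in this file is PROVED (no named facts); nothing already in the tree is restated
  (`∫ ρ_s = sⁿ`, MR07 Lemma 2.9 and Lemma 4.1 are imported, see above).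

## What is NOT here

BLPRS Lemmas 2.8–2.10 (above), Claim 2.1 and Lemma 2.2 (leftover hash over `ℤ_q`; topic
`Cryptography`), Lemma 2.3 / §5 (the exact sampler, an algorithm), Lemmas 2.12–2.15 and §3–§4 (the
LWE transformations; topic `Cryptography`).

## References

* Z. Brakerski, A. Langlois, C. Peikert, O. Regev, D. Stehlé, *Classical hardness of learning with
  errors*, STOC 2013, §2.2, Lemmas 2.5–2.10 (arXiv:1306.0281).
* O. Regev, *On lattices, learning with errors, random linear codes, and cryptography*, J. ACM 56
  (2009), Claims 3.8, 3.9, Cor. 3.10 (STOC 2005 version: Lemma 3.9).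
* D. Micciancio, O. Regev, *Worst-case to average-case reductions based on Gaussian measures*,
  SIAM J. Comput. 37 (2007), Lemma 4.1.
* C. Gentry, C. Peikert, V. Vaikuntanathan, *Trapdoors for hard lattices and new cryptographic
  constructions*, STOC 2008, Lemma 3.1.
* C. Peikert, *An efficient and parallel Gaussian sampler for lattices*, CRYPTO 2010, Thm 3.1.
-/

noncomputable section

open MeasureTheory Module
open scoped Real ENNReal InnerProductSpace

namespace Literature.Algebra.EuclideanLattices

/-! ### Statistical distance of measures (local glue) -/

section StatDist

variable {α : Type*} [MeasurableSpace α]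

/-- LOCAL GLUE. The *statistical distance* (total variation distance) of two measures on a
measurable space: `Δ(μ, ν) = sup_A |μ(A) - ν(A)|`, the supremum over measurable sets `A`, as a real
number (values of infinite measure are read through `Measure.real`, i.e. as `0`; the notion is meant
for finite measures, where the supremum is attained-bounded by `μ(univ) + ν(univ)`). For probability
measures this is the usual `max_A |μ(A) - ν(A)| = ½ ∫ |dμ - dν|` (BLPRS 2013, §2: "we define their
statistical distance as `∑ |P(i) - Q(i)|/2` … and extend this to continuous distributions in the
obvious way"). The tree's `PMF.tvDist` is the discrete special case. [cite: BrakerskiEtAl2013, §2] -/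
def statDist (μ ν : Measure α) : ℝ :=
  ⨆ A : {A : Set α // MeasurableSet A}, |μ.real A.1 - ν.real A.1|

/-- The statistical distance is nonnegative. [folklore] -/
theorem statDist_nonneg (μ ν : Measure α) : 0 ≤ statDist μ ν :=
  Real.iSup_nonneg fun _ => abs_nonneg _

/-- `Δ(μ, μ) = 0`. [folklore] -/
@[simp]
theorem statDist_self (μ : Measure α) : statDist μ μ = 0 := by
  simp [statDist]

/-- The statistical distance is symmetric. [folklore] -/
theorem statDist_comm (μ ν : Measure α) : statDist μ ν = statDist ν μ := by
  simp [statDist, abs_sub_comm]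

/-- To bound the statistical distance by `c ≥ 0` it suffices to bound `|μ(A) - ν(A)|` by `c` for
every measurable `A`. [folklore] -/
theorem statDist_le_of_forall_abs_sub_le {μ ν : Measure α} {c : ℝ} (hc : 0 ≤ c)
    (h : ∀ A : Set α, MeasurableSet A → |μ.real A - ν.real A| ≤ c) : statDist μ ν ≤ c :=
  Real.iSup_le (fun A => h A.1 A.2) hc

/-- For finite measures the differences `|μ(A) - ν(A)|` are bounded (by `μ(univ) + ν(univ)`), so the
supremum defining `statDist` is a genuine one. [folklore] -/
theorem bddAbove_range_abs_measureReal_sub (μ ν : Measure α) [IsFiniteMeasure μ]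
    [IsFiniteMeasure ν] :
    BddAbove (Set.range fun A : {A : Set α // MeasurableSet A} => |μ.real A.1 - ν.real A.1|) := by
  refine ⟨μ.real Set.univ + ν.real Set.univ, ?_⟩
  rintro _ ⟨A, rfl⟩
  have h1 : μ.real A.1 ≤ μ.real Set.univ := measureReal_mono (Set.subset_univ _)
  have h2 : ν.real A.1 ≤ ν.real Set.univ := measureReal_mono (Set.subset_univ _)
  have h3 : 0 ≤ μ.real A.1 := measureReal_nonneg
  have h4 : 0 ≤ ν.real A.1 := measureReal_nonneg
  rw [abs_le]
  constructor <;> linarith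

/-- Every measurable event witnesses a lower bound: `|μ(A) - ν(A)| ≤ Δ(μ, ν)` (finite measures).
[folklore] -/
theorem abs_measureReal_sub_le_statDist (μ ν : Measure α) [IsFiniteMeasure μ] [IsFiniteMeasure ν]
    {A : Set α} (hA : MeasurableSet A) : |μ.real A - ν.real A| ≤ statDist μ ν :=
  le_ciSup (f := fun A : {A : Set α // MeasurableSet A} => |μ.real A.1 - ν.real A.1|)
    (bddAbove_range_abs_measureReal_sub μ ν) ⟨A, hA⟩

end StatDist

/-! ### The continuous Gaussian `D_s` -/

section ContinuousGaussian

variable (E : Type*) [NormedAddCommGroup E] [InnerProductSpace ℝ E] [FiniteDimensional ℝ E]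
  [MeasurableSpace E] [BorelSpace E]

/-- The (spherical) *continuous Gaussian distribution* `D_s` on a finite-dimensional real inner
product space `E` of dimension `n`: the measure with density `ρ_s(x)/sⁿ = exp(-π‖x‖²/s²)/sⁿ` with
respect to Lebesgue measure (the volume of the inner product space), i.e. "the distribution with
density function proportional to `ρ_s`" (BLPRS 2013, §2.2; Regev 2009, §2 writes `ν_s`). For
`0 < s` it is a probability measure (`isProbabilityMeasure_continuousGaussian`); for `s ≤ 0` it is a
junk value (never used). [cite: BrakerskiEtAl2013, §2.2] -/
def continuousGaussian (s : ℝ) : Measure E :=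
  volume.withDensity fun x => ENNReal.ofReal (gaussianFunction s x / s ^ finrank ℝ E)

variable {E}

/-- Unfolding: `D_s(A) = ∫_A ρ_s(x)/sⁿ dx` for measurable `A`. [cite: BrakerskiEtAl2013, §2.2] -/
theorem continuousGaussian_apply (s : ℝ) {A : Set E} (hA : MeasurableSet A) :
    continuousGaussian E s A =
      ∫⁻ x in A, ENNReal.ofReal (gaussianFunction s x / s ^ finrank ℝ E) :=
  withDensity_apply _ hA

/-- For `0 < s`, `D_s` is a probability measure (its density integrates to `sⁿ/sⁿ = 1`, by the
tree's `integral_gaussianFunction_sub` / `integrable_gaussianFunction_sub`, MR07 §2 p. 8).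
[cite: BrakerskiEtAl2013, §2.2] -/
theorem isProbabilityMeasure_continuousGaussian {s : ℝ} (hs : 0 < s) :
    IsProbabilityMeasure (continuousGaussian E s) := by
  constructor
  rw [continuousGaussian, withDensity_apply _ MeasurableSet.univ, Measure.restrict_univ]
  have hint0 : Integrable (fun x : E => gaussianFunction s x) := by
    simpa only [sub_zero] using integrable_gaussianFunction_sub hs (0 : E)
  have hval : ∫ x : E, gaussianFunction s x = s ^ finrank ℝ E := by
    simpa only [sub_zero] using integral_gaussianFunction_sub hs (0 : E)
  have hint : Integrable (fun x : E => gaussianFunction s x / s ^ finrank ℝ E) := hint0.div_const _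
  have hnn : 0 ≤ᵐ[volume] fun x : E => gaussianFunction s x / s ^ finrank ℝ E :=
    Filter.Eventually.of_forall fun x => div_nonneg (gaussianFunction_pos s x).le (pow_nonneg hs.le _)
  rw [← ofReal_integral_eq_lintegral_ofReal hint hnn, integral_div, hval,
    div_self (pow_ne_zero _ hs.ne'), ENNReal.ofReal_one]

end ContinuousGaussian

section Lattice

variable {E : Type*} [NormedAddCommGroup E] [InnerProductSpace ℝ E] [FiniteDimensional ℝ E]
  [MeasurableSpace E] [BorelSpace E]
variable (L : Submodule ℤ E) [DiscreteTopology L] [IsZLattice ℝ L]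

/-! ### BLPRS Lemma 2.7: the Gaussian mass of a coset (lower bound; proved) -/

/-- **BLPRS 2013, Lemma 2.7, lower bound** (Regev 2009, from Claim 3.8): for a full-rank lattice `L`,
`0 < ε`, `0 < s` with `η_ε(L) ≤ s`, and every centre `c`,
`(1-ε)/(1+ε) · ρ_s(L) ≤ ρ_s(L - c) = ρ_{s,c}(L)`. Proof as printed: by Regev's Claim 3.8
(`abs_gaussianMass_div_sub_one_le_holds`) `ρ_{s,c}(L) ≥ (1-ε) sⁿ/vol(L)` and
`ρ_s(L) ≤ (1+ε) sⁿ/vol(L)`; for `ε ≥ 1` the factor `ofReal((1-ε)/(1+ε))` is `0`. Together with the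
upper bound `ρ_{s,c}(L) ≤ ρ_s(L)` (the tree's `gaussianMass_le_gaussianMass_zero_of_discrete`, MR07
Lemma 2.9) this is BLPRS's `ρ_s(L + c) ∈ [(1-ε)/(1+ε), 1] · ρ_s(L)`. [cite: BrakerskiEtAl2013, Lemma 2.7] -/
theorem ofReal_mul_gaussianMass_lattice_le {ε s : ℝ} (hε : 0 < ε) (hs : 0 < s)
    (hηs : smoothingParameter L ε ≤ s) (c : E) :
    ENNReal.ofReal ((1 - ε) / (1 + ε)) * gaussianMass s 0 (L : Set E) ≤
      gaussianMass s c (L : Set E) := by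
  rcases le_or_gt 1 ε with hε1 | hε1
  · have h0 : (1 - ε) / (1 + ε) ≤ 0 := div_nonpos_of_nonpos_of_nonneg (by linarith) (by linarith)
    rw [ENNReal.ofReal_of_nonpos h0, zero_mul]
    exact bot_le
  set K : ℝ := s ^ finrank ℝ E / ZLattice.covolume L with hK
  have hKpos : 0 < K := div_pos (pow_pos hs _) (ZLattice.covolume_pos L volume)
  have hc := abs_gaussianMass_div_sub_one_le_holds L hε hs hηs c
  have hz := abs_gaussianMass_div_sub_one_le_holds L hε hs hηs 0
  rw [← hK] at hc hz
  set a : ℝ := (gaussianMass s c (L : Set E)).toReal with ha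
  set b : ℝ := (gaussianMass s 0 (L : Set E)).toReal with hb
  have ha' : gaussianMass s c (L : Set E) = ENNReal.ofReal a :=
    (ENNReal.ofReal_toReal (gaussianMass_lattice_ne_top L hs.ne' c)).symm
  have hb' : gaussianMass s 0 (L : Set E) = ENNReal.ofReal b :=
    (ENNReal.ofReal_toReal (gaussianMass_lattice_ne_top L hs.ne' 0)).symm
  have hlow : (1 - ε) * K ≤ a := by
    have h1 : -ε ≤ a / K - 1 := (abs_le.1 hc).1
    have h2 : 1 - ε ≤ a / K := by linarith
    exact (le_div_iff₀ hKpos).1 h2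
  have hup : b ≤ (1 + ε) * K := by
    have h1 : b / K - 1 ≤ ε := (abs_le.1 hz).2
    have h2 : b / K ≤ 1 + ε := by linarith
    exact (div_le_iff₀ hKpos).1 h2
  have hfrac : 0 ≤ (1 - ε) / (1 + ε) := div_nonneg (by linarith) (by linarith)
  have hmain : (1 - ε) / (1 + ε) * b ≤ a := by
    calc (1 - ε) / (1 + ε) * b ≤ (1 - ε) / (1 + ε) * ((1 + ε) * K) :=
          mul_le_mul_of_nonneg_left hup hfrac
      _ = (1 - ε) * K := by
          have : (1 + ε) ≠ 0 := by linarith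
          field_simp
      _ ≤ a := hlow
  rw [ha', hb', ← ENNReal.ofReal_mul hfrac]
  exact ENNReal.ofReal_le_ofReal hmain

/-- **BLPRS 2013, Lemma 2.7, as printed** (both bounds bundled; the upper bound IS the tree's
`gaussianMass_le_gaussianMass_zero_of_discrete`, MR07 Lemma 2.9, re-exported here only to give the
printed statement one name): for `0 < ε`, `0 < s`, `η_ε(L) ≤ s` and every centre `c`,
`(1-ε)/(1+ε) · ρ_s(L) ≤ ρ_{s,c}(L) ≤ ρ_s(L)`. [cite: BrakerskiEtAl2013, Lemma 2.7] -/
theorem ofReal_mul_gaussianMass_lattice_le_and_le {ε s : ℝ} (hε : 0 < ε) (hs : 0 < s)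
    (hηs : smoothingParameter L ε ≤ s) (c : E) :
    ENNReal.ofReal ((1 - ε) / (1 + ε)) * gaussianMass s 0 (L : Set E) ≤ gaussianMass s c (L : Set E) ∧
      gaussianMass s c (L : Set E) ≤ gaussianMass s 0 (L : Set E) :=
  ⟨ofReal_mul_gaussianMass_lattice_le L hε hs hηs c, gaussianMass_le_gaussianMass_zero_of_discrete L hs c⟩

end Lattice

end Literature.Algebra.EuclideanLattices

end
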